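/-
Copyright (c) 2026 the pub-hodgecm-mathlib formalisation cell (harness21).  Prover seat hodgecm-mathlib-F0P3-p02 (g26), 2026-09-03.  E1 row 47c R-c «JACQUET FUNCTOR OF THE
SCHNEIDER–STUHLER RESOLUTION», FILE 1 «COINVARIANTS OF A BLOCK-PERMUTATION MODULE» (E1 keeper ∕ dealer F0P3a-p03 (g29) 02:13:33Z; census row 47
`CENSUS-NONELL-VANISHING.v1` §2 (A3c)).
-/
import Mathlib.RepresentationTheory.Coinvariants
import Mathlib.Algebra.DirectSum.Module
import Mathlib.LinearAlgebra.Finsupp.LSum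
import HarnessLib

/-!
# Coinvariants of a block-permutation module: `(⊕_{b} W_b)_N ≅ ⊕_{orbits} (W_{b₀})_{Stab b₀}` (Shapiro's lemma in degree `0`)

Topic `RepresentationTheory`; declarations in Mathlib's `Representation` namespace, dot-style next to `Representation.Coinvariants` (deliberate, lean/CONVENTIONS.md §2).
THEOREMS ONLY (no definition, no instance, no notation, no named fact, no `sorry`); Mathlib only.  Cell `pub/hodgecm-mathlib` (D-0151), crux H413 = `stmt-HodgeConjecture-24833`,
lane `--supports`; E1 BRICK LEDGER row 47c FILE 1 (the Jacquet module of the chain modules `C_q(X) = ⊕_F V^{U_F}·[F]` of the Schneider–Stuhler resolution under the unipotent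
radical `N`: census row 47 §2 (A3c) «`(C_q)_N ≅ ⊕_{F₀ ∈ B∖X_q} cInd_{T_c}^T (V^{U_{F₀}})_{N ∩ P_{F₀}}`»).  HONEST LABEL: count-neutral generic base layer; (R-SS) NOT chartered; E1 = PRINT
until the keeper's charter test; HC_CM is proved only modulo the 2 remaining named inputs (hLiu418 = `stmt-HodgeConjecture-24832`, h413 = `stmt-HodgeConjecture-24833`) until rung 0
closes.

THE MATHEMATICS (Shapiro's lemma for `H₀`, [Brown1982, III (6.2), (5.?)]; [BernsteinZelevinsky1976, §2.3]).  `τ` a representation of a group `N` on a `k`-space `M`, `M = ⊕_{b ∈ β} W_b`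
an INTERNAL direct sum of subspaces PERMUTED by `N` along an action `act` of `N` on the index set: `τ(n) W_b ⊆ W_{n·b}`.  For each orbit choose a representative (`rep b ∈ R`,
`rep` constant on orbits, `rep r = r` on `R`) and transporters `tr b ∈ N`, `tr b · rep b = b`.  The LOCAL KERNEL at `r ∈ R` is
`K_r := span{τ(s) w − w : s · r = r, w ∈ W_r} ≤ W_r` (the coinvariant kernel of the stabiliser on the block).  Then:
* (§2) every class of `M_N` is the class of a vector `Σ_{r ∈ R} w_r`, `w_r ∈ W_r`, finitely supported (transport each block component to its representative by `τ(tr b)⁻¹`: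
  `[m] = [τ(tr b)⁻¹ m]`) — `exists_finsupp_blocks_mk_sum_eq`;
* (§3) THE ORBIT-SUM FUNCTIONAL `Φ_r : M → M ⧸ K_r`, `m ↦ Σ_{b ∈ orbit of r} [τ(tr b)⁻¹ m_b]` (finite sum over the support of `m`), is `N`-invariant (a change of transporter is a
  stabiliser element: `(tr (n·b))⁻¹ n (tr b)` fixes `r`) hence vanishes on the coinvariant kernel, and `Φ_r w = [w]` for `w ∈ W_r`; so for `w ∈ W_r`:
  **`[w] = 0` in `M_N ↔ w ∈ K_r`** (`mk_eq_zero_iff_mem_localKer`) — the content of Shapiro's lemma;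
* (§4) different representatives are INDEPENDENT in `M_N`: `[Σ_r w_r] = 0 ↔ ∀ r, w_r ∈ K_r` (`mk_finsupp_sum_eq_zero_iff`) — i.e. `M_N ≅ ⊕_{r ∈ R} W_r ⧸ K_r`.
No finiteness of `β`, of the orbits or of `N` is assumed (the orbits of the unipotent radical on the Bruhat–Tits tree are infinite).  Consumer: 47c FILE 2 (the `ℤ`-grading of
`(C_q)_N` by the `N`-orbits inside a `B`-orbit, `τ`-shift) and FILE 3 (assembly with the ★ Jacquet exactness `exists_normalizedJacquet_shortExact` on the ★ 41d short exact sequence).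

## References
* [Brown1982] K. S. Brown, *Cohomology of Groups* (1982): III §5–§6 (induced and co-induced modules; Shapiro's lemma; `H₀` of an induced module = coinvariants of the inducing module).
* [BernsteinZelevinsky1976] I. N. Bernstein, A. V. Zelevinsky, *Representations of the group GL(n, F)…*, Russian Math. Surveys 31 (1976): §2.3 (coinvariants `V_N`, the Jacquet functor).
* [Casselman1995] W. Casselman, *Introduction to the theory of admissible representations of p-adic reductive groups*: §3.1–§3.2 (Jacquet modules of induced representations).
-/

set_option autoImplicit false

open scoped BigOperators DirectSum

namespace Representation

variable {k N M : Type*} [Field k] [Group N] [AddCommGroup M] [Module k M] {τ : Representation k N M}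
variable {β : Type*} {Blk : β → Submodule k M} {act : N → β → β}

/-! ## §1 Transport along the orbit; the local kernel -/

/-- **Transport back to the representative**: if `τ(n) W_b ⊆ W_{n·b}` for all `n, b` and `act` is an action, then `τ(n)⁻¹` maps `W_{n·b}` into `W_b`. [cite: Brown1982, III §5] -/
theorem apply_inv_mem_block (hact : ∀ n n' b, act (n * n') b = act n (act n' b)) (hact1 : ∀ b, act 1 b = b)
    (hperm : ∀ n b m, m ∈ Blk b → τ n m ∈ Blk (act n b)) {n : N} {b : β} {m : M} (hm : m ∈ Blk (act n b)) : τ n⁻¹ m ∈ Blk b := by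
  have h := hperm n⁻¹ (act n b) m hm
  rwa [← hact, inv_mul_cancel, hact1] at h

/-- The class of a vector is the class of its transport: `[m] = [τ(n)⁻¹ m]` in `M_N`. [cite: BernsteinZelevinsky1976, §2.3] -/
theorem coinvariants_mk_eq_mk_apply_inv (n : N) (m : M) : Coinvariants.mk τ m = Coinvariants.mk τ (τ n⁻¹ m) := by
  conv_lhs => rw [show m = τ n (τ n⁻¹ m) by rw [← Module.End.mul_apply, ← map_mul, mul_inv_cancel, map_one, Module.End.one_apply]]
  exact Coinvariants.mk_self_apply τ n _

/-- **The local kernel lies in the block**: `K_r = span{τ(s) w − w : s·r = r, w ∈ W_r} ≤ W_r`. [cite: Brown1982, III §6 (6.2)] -/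
theorem localKer_le_block (hperm : ∀ n b m, m ∈ Blk b → τ n m ∈ Blk (act n b)) (r : β) :
    Submodule.span k {x : M | ∃ (s : N) (w : M), act s r = r ∧ w ∈ Blk r ∧ x = τ s w - w} ≤ Blk r := by
  refine Submodule.span_le.2 ?_
  rintro _ ⟨s, w, hs, hw, rfl⟩
  have h := hperm s r w hw
  rw [hs] at h
  exact Submodule.sub_mem _ h hw

/-- **The local kernel dies in the coinvariants**: `w ∈ K_r ⇒ [w] = 0` in `M_N`. [cite: Brown1982, III §6 (6.2)] -/
theorem coinvariants_mk_eq_zero_of_mem_localKer (r : β) {w : M}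
    (hw : w ∈ Submodule.span k {x : M | ∃ (s : N) (w : M), act s r = r ∧ w ∈ Blk r ∧ x = τ s w - w}) : Coinvariants.mk τ w = 0 := by
  rw [Coinvariants.mk_eq_zero]
  refine (Submodule.span_le.2 ?_) hw
  rintro _ ⟨s, w', -, -, rfl⟩
  exact Coinvariants.sub_mem_ker s w'

/-! ## §2 Surjectivity from the representatives -/

/-- **Every class comes from the representatives**: for `M = ⊕_b W_b` internal and orbit data (`rep`, `tr` with `tr b · rep b = b`, `rep b ∈ R`), every element of `M_N` is the class of
`Σ_r f r` for a finitely supported `f` with `f r ∈ W_r` and `supp f ⊆ R`. [cite: Brown1982, III §5–§6] [cite: BernsteinZelevinsky1976, §2.3] -/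
theorem exists_finsupp_blocks_mk_sum_eq [DecidableEq β] (h : DirectSum.IsInternal Blk) (hact : ∀ n n' b, act (n * n') b = act n (act n' b))
    (hact1 : ∀ b, act 1 b = b) (hperm : ∀ n b m, m ∈ Blk b → τ n m ∈ Blk (act n b)) {R : Set β} (rep : β → β) (tr : β → N)
    (hrepR : ∀ b, rep b ∈ R) (htr : ∀ b, act (tr b) (rep b) = b) (x : Coinvariants τ) :
    ∃ f : β →₀ M, (∀ b ∈ f.support, b ∈ R) ∧ (∀ b, f b ∈ Blk b) ∧ Coinvariants.mk τ (f.sum fun _ m => m) = x := by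
  classical
  induction x using Coinvariants.induction_on with
  | h m =>
    -- decompose `m` along the blocks
    set e := LinearEquiv.ofBijective (DirectSum.coeLinearMap Blk) h with he
    set c : Π₀ b, ↥(Blk b) := e.symm m with hc
    have hm : m = ∑ b ∈ c.support, ((c b : Blk b) : M) := by
      have h1 : m = DirectSum.coeLinearMap Blk (e.symm m) := (e.apply_symm_apply m).symm
      rw [h1, DirectSum.coeLinearMap_eq_dfinsuppSum]
      rfl
    -- the transported finsupp
    let f : β →₀ M := ∑ b ∈ c.support, Finsupp.single (rep b) (τ (tr b)⁻¹ ((c b : Blk b) : M))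
    have hfapply : ∀ b', f b' = ∑ b ∈ c.support, Finsupp.single (rep b) (τ (tr b)⁻¹ ((c b : Blk b) : M)) b' := fun b' => by
      change (∑ b ∈ c.support, Finsupp.single (rep b) (τ (tr b)⁻¹ ((c b : Blk b) : M))) b' = _
      rw [Finsupp.finsetSum_apply]
    have hfmem : ∀ b, f b ∈ Blk b := by
      intro b
      rw [hfapply]
      refine Submodule.sum_mem _ fun b' _ => ?_
      rw [Finsupp.single_apply]
      split_ifs with hb
      · rw [← hb]
        refine apply_inv_mem_block hact hact1 hperm ?_
        rw [htr]; exact (c b').2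
      · exact Submodule.zero_mem _
    refine ⟨f, fun b hb => ?_, hfmem, ?_⟩
    · -- support ⊆ R
      have hb' : b ∈ (∑ b ∈ c.support, Finsupp.single (rep b) (τ (tr b)⁻¹ ((c b : Blk b) : M))).support := hb
      obtain ⟨b', -, hb''⟩ := Finset.mem_biUnion.1 (Finsupp.support_finsetSum hb')
      have := Finsupp.support_single_subset hb''
      rw [Finset.mem_singleton] at this
      rw [this]; exact hrepR b'
    · -- the class: `Σ_r f r = Σ_b τ(tr b)⁻¹ m_b` and `[τ(tr b)⁻¹ m_b] = [m_b]`
      have hsum : (f.sum fun _ m => m) = ∑ b ∈ c.support, τ (tr b)⁻¹ ((c b : Blk b) : M) := by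
        change ((∑ b ∈ c.support, Finsupp.single (rep b) (τ (tr b)⁻¹ ((c b : Blk b) : M))).sum fun _ m => m) = _
        rw [← Finsupp.sum_finsetSum_index (fun _ => rfl) (fun _ _ _ => rfl)]
        exact Finset.sum_congr rfl fun b _ => Finsupp.sum_single_index rfl
      rw [hsum, hm, map_sum, map_sum]
      exact Finset.sum_congr rfl fun b _ => (coinvariants_mk_eq_mk_apply_inv (tr b) _).symm

/-! ## §3 The orbit-sum functional and the kernel on a block -/

/-- **THE ORBIT-SUM FUNCTIONAL.**  For `M = ⊕_b W_b` internal and orbit data there is, for each `r`, a linear `Φ_r : M → M ⧸ K_r` with (i) `Φ_r m = [τ(tr b)⁻¹ m]` for `m ∈ W_b` in the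
orbit of `r` (`rep b = r`) and `Φ_r m = 0` for `m ∈ W_b` off the orbit, and (ii) `Φ_r (τ n m) = Φ_r m` for all `n, m` (a change of transporter `(tr (n·b))⁻¹ · n · tr b` STABILISES `r`, so
it moves `τ(tr b)⁻¹ m_b` inside its class modulo `K_r`). [cite: Brown1982, III §5–§6] -/
theorem exists_orbitSum_functional [DecidableEq β] (h : DirectSum.IsInternal Blk) (hact : ∀ n n' b, act (n * n') b = act n (act n' b))
    (hact1 : ∀ b, act 1 b = b) (hperm : ∀ n b m, m ∈ Blk b → τ n m ∈ Blk (act n b)) (rep : β → β) (tr : β → N)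
    (htr : ∀ b, act (tr b) (rep b) = b) (hrep_act : ∀ n b, rep (act n b) = rep b) (r : β) :
    ∃ Φ : M →ₗ[k] M ⧸ Submodule.span k {x : M | ∃ (s : N) (w : M), act s r = r ∧ w ∈ Blk r ∧ x = τ s w - w},
      (∀ b m, m ∈ Blk b → rep b = r → Φ m = Submodule.Quotient.mk (τ (tr b)⁻¹ m)) ∧ (∀ b m, m ∈ Blk b → rep b ≠ r → Φ m = 0) ∧
      ∀ (n : N) (m : M), Φ (τ n m) = Φ m := by
  classical
  set K := Submodule.span k {x : M | ∃ (s : N) (w : M), act s r = r ∧ w ∈ Blk r ∧ x = τ s w - w} with hK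
  set e := LinearEquiv.ofBijective (DirectSum.coeLinearMap Blk) h with he
  -- the functional on the external direct sum
  let ψ : (⨁ b, Blk b) →ₗ[k] M ⧸ K :=
    DirectSum.toModule k β (M ⧸ K) fun b => if rep b = r then K.mkQ ∘ₗ (τ (tr b)⁻¹).domRestrict (Blk b) else 0
  have hψ : ∀ (b : β) (mb : Blk b), ψ (DirectSum.lof k β (fun b => ↥(Blk b)) b mb) =
      if rep b = r then Submodule.Quotient.mk (τ (tr b)⁻¹ (mb : M)) else 0 := by
    intro b mb
    change DirectSum.toModule k β (M ⧸ K) _ (DirectSum.lof k β (fun b => ↥(Blk b)) b mb) = _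
    rw [DirectSum.toModule_lof]
    split_ifs with hb
    · rfl
    · rfl
  let Φ : M →ₗ[k] M ⧸ K := ψ ∘ₗ e.symm.toLinearMap
  have hΦ : ∀ b m (hm : m ∈ Blk b), Φ m = if rep b = r then Submodule.Quotient.mk (τ (tr b)⁻¹ m) else 0 := by
    intro b m hm
    have hsymm : e.symm m = DirectSum.lof k β (fun b => ↥(Blk b)) b ⟨m, hm⟩ := by
      apply e.injective
      rw [LinearEquiv.apply_symm_apply]
      exact (DirectSum.coeLinearMap_lof Blk b ⟨m, hm⟩).symm
    change ψ (e.symm m) = _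
    rw [hsymm, hψ]
  refine ⟨Φ, fun b m hm hb => by rw [hΦ b m hm, if_pos hb], fun b m hm hb => by rw [hΦ b m hm, if_neg hb], fun n m => ?_⟩
  -- invariance: check on the generators `lof b mb`
  suffices hcomp : (Φ ∘ₗ τ n) ∘ₗ e.toLinearMap = Φ ∘ₗ e.toLinearMap by
    have := LinearMap.congr_fun hcomp (e.symm m)
    simpa only [LinearMap.coe_comp, Function.comp_apply, LinearEquiv.coe_toLinearMap, LinearEquiv.apply_symm_apply] using this
  refine DirectSum.linearMap_ext k fun b => LinearMap.ext fun mb => ?_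
  have hmb : (mb : M) ∈ Blk b := mb.2
  have heb : e (DirectSum.lof k β (fun b => ↥(Blk b)) b mb) = (mb : M) := DirectSum.coeLinearMap_lof Blk b mb
  simp only [LinearMap.coe_comp, Function.comp_apply, LinearEquiv.coe_toLinearMap, heb]
  rw [hΦ _ _ (hperm n b _ hmb), hΦ b _ hmb, hrep_act]
  split_ifs with hb
  · -- the two transports differ by the stabiliser element `s = (tr (n·b))⁻¹ * n * tr b`
    rw [Submodule.Quotient.eq]
    set w : M := τ (tr b)⁻¹ (mb : M) with hw
    have hwr : w ∈ Blk r := by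
      rw [hw, ← hb]
      refine apply_inv_mem_block hact hact1 hperm ?_
      rw [htr]; exact hmb
    set s : N := (tr (act n b))⁻¹ * n * tr b with hs
    have h1 : act (tr (act n b))⁻¹ (act (tr (act n b)) (rep (act n b))) = rep (act n b) := by
      rw [← hact, inv_mul_cancel, hact1]
    rw [htr] at h1
    have hsr : act s r = r := by
      rw [hs, hact, hact, ← hb, htr, h1, hrep_act]
    have hsw : τ s w = τ (tr (act n b))⁻¹ (τ n (mb : M)) := by
      rw [hs, hw, map_mul, map_mul, Module.End.mul_apply, Module.End.mul_apply, ← Module.End.mul_apply (τ (tr b)), ← map_mul,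
        mul_inv_cancel, map_one, Module.End.one_apply]
    rw [← hsw]
    exact Submodule.subset_span ⟨s, w, hsr, hwr, rfl⟩
  · rfl

/-- **SHAPIRO'S LEMMA IN DEGREE `0`, KERNEL FORM.**  For `M = ⊕_b W_b` internal, blocks permuted along an action (`τ(n) W_b ⊆ W_{n·b}`), orbit data (`rep`, `tr`; `rep` constant on
orbits, `rep r = r` for `r ∈ R`), a representative `r ∈ R` and `w ∈ W_r`:  **`[w] = 0` in `M_N` iff `w ∈ K_r = span{τ(s) w′ − w′ : s·r = r, w′ ∈ W_r}`.**
[cite: Brown1982, III §6 (6.2)] [cite: BernsteinZelevinsky1976, §2.3] -/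
theorem coinvariants_mk_eq_zero_iff_mem_localKer [DecidableEq β] (h : DirectSum.IsInternal Blk) (hact : ∀ n n' b, act (n * n') b = act n (act n' b))
    (hact1 : ∀ b, act 1 b = b) (hperm : ∀ n b m, m ∈ Blk b → τ n m ∈ Blk (act n b)) {R : Set β} (rep : β → β) (tr : β → N)
    (htr : ∀ b, act (tr b) (rep b) = b) (hrep_act : ∀ n b, rep (act n b) = rep b) (hrep_id : ∀ r ∈ R, rep r = r)
    {r : β} (hr : r ∈ R) {w : M} (hw : w ∈ Blk r) :
    Coinvariants.mk τ w = 0 ↔ w ∈ Submodule.span k {x : M | ∃ (s : N) (w : M), act s r = r ∧ w ∈ Blk r ∧ x = τ s w - w} := by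
  refine ⟨fun h0 => ?_, coinvariants_mk_eq_zero_of_mem_localKer r⟩
  obtain ⟨Φ, hΦon, -, hΦinv⟩ := exists_orbitSum_functional h hact hact1 hperm rep tr htr hrep_act r
  -- `Φ` kills the coinvariant kernel
  have hker : Coinvariants.ker τ ≤ LinearMap.ker Φ := by
    refine Submodule.span_le.2 ?_
    rintro _ ⟨⟨n, m⟩, rfl⟩
    simp only [SetLike.mem_coe, LinearMap.mem_ker, map_sub, hΦinv, sub_self]
  have hΦw : Φ w = 0 := hker ((Coinvariants.mk_eq_zero τ).1 h0)
  -- and `Φ w = [τ(tr r)⁻¹ w] = [w]`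
  rw [hΦon r w hw (hrep_id r hr), Submodule.Quotient.mk_eq_zero] at hΦw
  have hfix : act (tr r) r = r := by
    have := htr r
    rwa [hrep_id r hr] at this
  have hw' : τ (tr r)⁻¹ w ∈ Blk r := by
    refine apply_inv_mem_block hact hact1 hperm ?_
    rw [hfix]; exact hw
  -- `w = τ(tr r) (τ(tr r)⁻¹ w) = (τ s w′ − w′) + w′` with `s = tr r`, `w′ = τ(tr r)⁻¹ w`
  have hdecomp : w = (τ (tr r) (τ (tr r)⁻¹ w) - τ (tr r)⁻¹ w) + τ (tr r)⁻¹ w := by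
    rw [sub_add_cancel, ← Module.End.mul_apply, ← map_mul, mul_inv_cancel, map_one, Module.End.one_apply]
  rw [hdecomp]
  exact Submodule.add_mem _ (Submodule.subset_span ⟨tr r, _, hfix, hw', rfl⟩) hΦw

/-! ## §4 Independence of the representatives -/

/-- **THE REPRESENTATIVES ARE INDEPENDENT IN `M_N`**: for `f` finitely supported on `R` with `f r ∈ W_r`, `[Σ_r f r] = 0 ↔ ∀ r, f r ∈ K_r` — together with §2,
`M_N ≅ ⊕_{r ∈ R} W_r ⧸ K_r`. [cite: Brown1982, III §5–§6] [cite: BernsteinZelevinsky1976, §2.3] -/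
theorem coinvariants_mk_finsupp_sum_eq_zero_iff [DecidableEq β] (h : DirectSum.IsInternal Blk) (hact : ∀ n n' b, act (n * n') b = act n (act n' b))
    (hact1 : ∀ b, act 1 b = b) (hperm : ∀ n b m, m ∈ Blk b → τ n m ∈ Blk (act n b)) {R : Set β} (rep : β → β) (tr : β → N)
    (htr : ∀ b, act (tr b) (rep b) = b) (hrep_act : ∀ n b, rep (act n b) = rep b) (hrep_id : ∀ r ∈ R, rep r = r)
    (f : β →₀ M) (hfR : ∀ b ∈ f.support, b ∈ R) (hfmem : ∀ b, f b ∈ Blk b) :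
    Coinvariants.mk τ (f.sum fun _ m => m) = 0 ↔
      ∀ r, f r ∈ Submodule.span k {x : M | ∃ (s : N) (w : M), act s r = r ∧ w ∈ Blk r ∧ x = τ s w - w} := by
  classical
  constructor
  · intro h0 r
    by_cases hr : r ∈ f.support
    · have hrR : r ∈ R := hfR r hr
      obtain ⟨Φ, hΦon, hΦoff, hΦinv⟩ := exists_orbitSum_functional h hact hact1 hperm rep tr htr hrep_act r
      have hker : Coinvariants.ker τ ≤ LinearMap.ker Φ := by
        refine Submodule.span_le.2 ?_
        rintro _ ⟨⟨n, m⟩, rfl⟩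
        simp only [SetLike.mem_coe, LinearMap.mem_ker, map_sub, hΦinv, sub_self]
      have hΦ0 : Φ (f.sum fun _ m => m) = 0 := hker ((Coinvariants.mk_eq_zero τ).1 h0)
      -- `Φ (Σ_b f b) = Φ (f r)` : the other representatives are off the orbit of `r`
      rw [Finsupp.sum, map_sum, Finset.sum_eq_single r] at hΦ0
      · -- now `Φ (f r) = 0` gives `[f r] = 0` … reuse the kernel theorem through `Φ`'s value
        have hval := hΦon r (f r) (hfmem r) (hrep_id r hrR)
        rw [hval, Submodule.Quotient.mk_eq_zero] at hΦ0
        have hfix : act (tr r) r = r := by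
          have := htr r
          rwa [hrep_id r hrR] at this
        have hw' : τ (tr r)⁻¹ (f r) ∈ Blk r := by
          refine apply_inv_mem_block hact hact1 hperm ?_
          rw [hfix]; exact hfmem r
        have hdecomp : f r = (τ (tr r) (τ (tr r)⁻¹ (f r)) - τ (tr r)⁻¹ (f r)) + τ (tr r)⁻¹ (f r) := by
          rw [sub_add_cancel, ← Module.End.mul_apply, ← map_mul, mul_inv_cancel, map_one, Module.End.one_apply]
        rw [hdecomp]
        exact Submodule.add_mem _ (Submodule.subset_span ⟨tr r, _, hfix, hw', rfl⟩) hΦ0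
      · intro b hb hbr
        exact hΦoff b (f b) (hfmem b) (by rw [hrep_id b (hfR b hb)]; exact hbr)
      · intro hr'
        exact absurd hr hr'
    · rw [Finsupp.notMem_support_iff.1 hr]
      exact Submodule.zero_mem _
  · intro hall
    rw [Finsupp.sum, map_sum]
    exact Finset.sum_eq_zero fun r _ => coinvariants_mk_eq_zero_of_mem_localKer r (hall r)

end Representation
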